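import Summits.CriticalPhenomena.CardyFormulaZ2.Theorems.CardyMagicRigidityMarkovCascadeDefs
import Summits.CriticalPhenomena.CardyFormulaZ2.Theorems.CardyMagicRigidityNestingRigidityOneGenerationTInterior
import Summits.CriticalPhenomena.CardyFormulaZ2.Theorems.CardyMagicRigidityNestingRigidityOneGenerationTLocality
import HarnessLib

/-!
# Stub `stub_oneGenerationT`: the exact one-generation factorisation of the nesting transform on `𝕋`

Crux `Summit.CriticalPhenomena.CardyFormulaZ2.Theses.CardyMagicRigidity.NestingRigidity`
(stmt-CriticalPhenomena-4835), line `markov-cascade-one-generation`, registered stub S2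
`stub_oneGenerationT : OneGenerationT` (vocabulary `Theorems/CardyMagicRigidityMarkovCascadeDefs.lean`):
for `δ > 0`, a closed honeycomb walk `γ`, a density `f` carried by the winding interior
`G = {W(siteLoopCurve δ γ, ·) ≠ 0}` with `∫ f = 0`, and any measurable event `B = {ω ∩ outsideSitesT γ ∈ B₀}`
of the sites outside `γ`,
`E[A_f(siteLoopConfig δ ω) ; I_γ ∩ B] = M_γ(f) · P(I_γ ∩ B)` under `PT = P_{1/2}`, where
`I_γ = {IsSiteInterfaceLoop ω γ}` and `M_γ(f) = condTransformT δ γ f = E[∏_{u inside γ} cos_μ(f(int u)) ; I_γ] / P(I_γ)`.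

Proof (the domain-Markov property in transform form; a pure lattice theorem).
* §1 the three site sets `insideSitesT γ`, `loopSitesT γ`, `outsideSitesT γ` are pairwise disjoint; `I_γ`
  is a cylinder event of `loopSitesT γ` which it pins (`…Locality`: `isSiteInterfaceLoop_congr`,
  `mem_iff_of_read`); `insideSitesT γ` is finite.
* §2 LOCALITY of the inside loops: on `I_γ`, an interface loop `γ'` of `ω` whose interior lies in `G`
  reads only sites of `insideSitesT γ ∪ loopSitesT γ` (`loopWind_ne_zero_of_enclosed`: winding jump across
  a crossed edge, transport across an uncrossed one, `W(siteLoopCurve) = loopWind` and scale invariance from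
  `…Interior`), so `insideLoopsT δ γ ω` only depends on `ω` through those sites (`insideLoopsT_eq_of_agree`).
* §3 FACTOR ONE outside: on `I_γ` every loop `u` of `ω` not inside `γ` has interior containing `G` or
  disjoint from it (`interior_trichotomy`, Jordan), hence phase `∫ f = 0` or `0` and weight `2cos(π/3) = 1`:
  `A_f(siteLoopConfig δ ω) = ∏_{u ∈ insideLoopsT δ γ ω} cos_μ(f(int u))` (`nestingWeight_eq_finprod_insideLoopsT`).
* §4 INDEPENDENCE: pin the read sites to their forced values (`ρ ω = (ω ∩ inside) ∪ (ω₀ ∩ read)`); the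
  observable `H = (∏ inside factors) ∘ ρ` is determined by the finite set `insideSitesT γ` (hence measurable)
  and agrees with `A_f` on `I_γ`, while `1_{I_γ ∩ B}` is determined by `loopSitesT γ ∪ outsideSitesT γ`;
  coordinates of the product measure are independent (`integral_mul_of_determined`), so
  `E[A_f ; I_γ ∩ B] = E[H] P(I_γ ∩ B)` and `M_γ(f) = E[H] P(I_γ)/P(I_γ) = E[H]` (both sides vanish when
  `P(I_γ) = 0` or `I_γ = ∅`).
-/

noncomputable section

open MeasureTheory Set Filter
open scoped Topology BigOperators ENNReal Real

namespace Summit.CriticalPhenomena.CardyFormulaZ2.Cruxes.NestingRigidity.MarkovCascadeOneGeneration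

open Literature.Probability.RandomPlanarGeometry Literature.Probability.Percolation
  Literature.Probability.LatticeModels

variable {v : HexVertex} {γ : hexGraph.Walk v v}

/-! ## §1 The three site sets -/

/-- Inside sites are not read by `I_γ`. -/
theorem disjoint_insideSitesT_loopSitesT : Disjoint (insideSitesT γ) (loopSitesT γ) :=
  Set.disjoint_left.2 fun _ hx ↦ hx.2

/-- Inside and outside sites are disjoint. -/
theorem disjoint_insideSitesT_outsideSitesT : Disjoint (insideSitesT γ) (outsideSitesT γ) :=
  Set.disjoint_left.2 fun _ hx hx' ↦ hx.1 hx'.1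

/-- A site about which `siteLoopCurve 1 γ` winds is inside or read. -/
theorem mem_insideSitesT_union_loopSitesT {x : Site 2} (hx : (siteLoopCurve 1 γ).wind (triMeshPoint 1 x) ≠ 0) :
    x ∈ insideSitesT γ ∪ loopSitesT γ := by
  by_cases h : x ∈ loopSitesT γ
  · exact Or.inr h
  · exact Or.inl ⟨hx, h⟩

/-- **`insideSitesT γ` is finite** (when `γ` can be an interface loop at all). -/
theorem finite_insideSitesT {ω₀ : SiteConfig (Site 2)} (h₀ : IsSiteInterfaceLoop ω₀ γ) :
    (insideSitesT γ).Finite := by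
  have hlen : 0 < γ.length := by have := h₀.isCycle.three_le_length; omega
  refine (finite_setOf_loopWind_ne_zero (w := γ) one_pos hlen).subset fun x hx ↦ ?_
  change loopWind 1 γ (triMeshPoint 1 x) ≠ 0
  rw [← wind_siteLoopCurve_eq_loopWind hlen (h₀.triMeshPoint_not_mem_polyTrace one_pos x)]
  exact hx.1

/-- Indicators of `1` agree at two points with the same membership. -/
theorem indicator_one_congr_of_iff {α : Type*} {s : Set α} {a b : α} (h : a ∈ s ↔ b ∈ s) :
    s.indicator (1 : α → ℝ) a = s.indicator 1 b := by
  by_cases ha : a ∈ s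
  · rw [indicator_of_mem ha, indicator_of_mem (h.1 ha)]; rfl
  · rw [indicator_of_notMem ha, indicator_of_notMem (mt h.2 ha)]

/-! ## §2 Locality of the inside loops -/

/-- **An enclosed interface loop reads only inside or read sites**: if `γ`, `γ'` are interface loops of
one configuration and the winding interior of `siteLoopCurve δ γ'` lies in that of `siteLoopCurve δ γ`,
then `loopSitesT γ' ⊆ insideSitesT γ ∪ loopSitesT γ`. -/
theorem loopSitesT_subset_of_interior_subset {ω : SiteConfig (Site 2)} (hω : IsSiteInterfaceLoop ω γ)
    {v' : HexVertex} {γ' : hexGraph.Walk v' v'} (hγ' : IsSiteInterfaceLoop ω γ') {δ : ℝ} (hδ : 0 < δ)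
    (hUG : {z | (siteLoopCurve δ γ').wind z ≠ 0} ⊆ {z | (siteLoopCurve δ γ).wind z ≠ 0}) :
    loopSitesT γ' ⊆ insideSitesT γ ∪ loopSitesT γ := by
  have hlen : 0 < γ.length := by have := hω.isCycle.three_le_length; omega
  have hlen' : 0 < γ'.length := by have := hγ'.isCycle.three_le_length; omega
  have hsub : ∀ x : Site 2, loopWind δ γ' (triMeshPoint δ x) ≠ 0 → loopWind δ γ (triMeshPoint δ x) ≠ 0 := by
    intro x hx
    rw [← wind_siteLoopCurve_eq_loopWind hlen' (hγ'.triMeshPoint_not_mem_polyTrace hδ x)] at hx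
    rw [← wind_siteLoopCurve_eq_loopWind hlen (hω.triMeshPoint_not_mem_polyTrace hδ x)]
    exact hUG hx
  have key : ∀ y, loopWind δ γ (triMeshPoint δ y) ≠ 0 → y ∈ insideSitesT γ ∪ loopSitesT γ := fun y hy ↦ by
    refine mem_insideSitesT_union_loopSitesT ?_
    rw [← wind_siteLoopCurve_triMeshPoint hδ.ne',
      wind_siteLoopCurve_eq_loopWind hlen (hω.triMeshPoint_not_mem_polyTrace hδ y)]
    exact hy
  rintro x ⟨d, hd, e, he, hxe⟩
  obtain ⟨i, hi, hx⟩ := exists_eq_lv_or_rv hγ' hd he hxe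
  rcases loopWind_ne_zero_of_enclosed hω hγ' hδ hsub hi with ⟨hl, hr⟩ | ⟨j, hj, hij⟩
  · rcases hx with rfl | rfl
    · exact key _ hl
    · exact key _ hr
  · right
    rcases hx with rfl | rfl <;> rcases hij with ⟨h1, h2⟩ | ⟨h1, h2⟩
    · rw [h1]; exact lv_read hω hj
    · rw [h1]; exact rv_read hω hj
    · rw [h2]; exact rv_read hω hj
    · rw [h2]; exact lv_read hω hj

/-- **Locality of the inside loops.**  Two configurations carrying the interface loop `γ` and agreeing on
`insideSitesT γ ∪ loopSitesT γ` have the same loops inside `γ` (same walks, same types). -/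
theorem insideLoopsT_eq_of_agree {ω ω' : SiteConfig (Site 2)} (hω : IsSiteInterfaceLoop ω γ)
    (hω' : IsSiteInterfaceLoop ω' γ) {δ : ℝ} (hδ : 0 < δ)
    (h : ∀ x ∈ insideSitesT γ ∪ loopSitesT γ, x ∈ ω ↔ x ∈ ω') :
    insideLoopsT δ γ ω = insideLoopsT δ γ ω' := by
  suffices key : ∀ {ω ω' : SiteConfig (Site 2)}, IsSiteInterfaceLoop ω γ → IsSiteInterfaceLoop ω' γ →
      (∀ x ∈ insideSitesT γ ∪ loopSitesT γ, x ∈ ω ↔ x ∈ ω') → insideLoopsT δ γ ω ⊆ insideLoopsT δ γ ω' from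
    Subset.antisymm (key hω hω' h) (key hω' hω fun x hx ↦ (h x hx).symm)
  intro ω ω' hω hω' h u hu
  obtain ⟨hu, hUG⟩ := hu
  refine ⟨?_, hUG⟩
  have transfer : ∀ i : Fin 2, u ∈ (siteLoopConfig δ ω).F i → u ∈ (siteLoopConfig δ ω').F i := by
    rintro i ⟨v', γ', hγ', htype, rfl⟩
    have hread := loopSitesT_subset_of_interior_subset hω hγ' hδ hUG
    exact ⟨v', γ', (isSiteInterfaceLoop_congr fun x hx ↦ h x (hread hx)).1 hγ', htype, rfl⟩
  rcases hu with hu | hu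
  · exact Or.inl (transfer 0 hu)
  · exact Or.inr (transfer 1 hu)

/-! ## §3 Factor one for the loops not inside `γ` -/

/-- **On `I_γ` the nesting weight is the product over the inside loops**: every other loop of `ω` has
winding interior containing the support of `f` or disjoint from it (`interior_trichotomy`) and weighs `1`. -/
theorem nestingWeight_eq_finprod_insideLoopsT {ω : SiteConfig (Site 2)} (hω : IsSiteInterfaceLoop ω γ)
    {δ : ℝ} (hδ : 0 < δ) {f : ℂ → ℝ} (hf : ∀ z, f z ≠ 0 → (siteLoopCurve δ γ).wind z ≠ 0) (hf0 : ∫ z, f z = 0) :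
    (siteLoopConfig δ ω).nestingWeight f = ∏ᶠ u ∈ insideLoopsT δ γ ω, u.nestingFactor f := by
  rw [LoopConfig.nestingWeight]
  refine finprod_mem_eq_of_eq_one_off (fun u hu ↦ hu.1) _ fun u hu hnot ↦ ?_
  have hUG : ¬ {z | u.wind z ≠ 0} ⊆ {z | (siteLoopCurve δ γ).wind z ≠ 0} := fun h ↦ hnot ⟨hu, h⟩
  obtain ⟨v', γ', hγ', rfl⟩ : ∃ (v' : HexVertex) (γ' : hexGraph.Walk v' v'), IsSiteInterfaceLoop ω γ' ∧
      u = UnbasedLoop.mk (BasedLoop.mk (siteLoopCurve δ γ') (isLoop_siteLoopCurve δ γ')) := by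
    rcases hu with ⟨v', γ', h1, -, h3⟩ | ⟨v', γ', h1, -, h3⟩ <;> exact ⟨v', γ', h1, h3⟩
  refine nestingFactor_eq_one_of_subset_or_disjoint (G := {z | (siteLoopCurve δ γ).wind z ≠ 0}) hf hf0 ?_
  rcases interior_trichotomy hω hγ' hδ with h | h | h
  · exact absurd h hUG
  · exact Or.inl h
  · exact Or.inr h

/-! ## §4 The factorisation -/

/-- **STUB S2 — the exact one-generation factorisation of the `μ = 1/6` nesting transform on site-`𝕋`**
(the registered statement; it is `OneGenerationT` unfolded, `oneGenerationT_of_stub`). -/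
theorem stub_oneGenerationT : ∀ (δ : ℝ) (v : HexVertex) (γ : hexGraph.Walk v v) (f : ℂ → ℝ) (B₀ : Set (Set (Site 2))), 0 < δ → (∀ z, f z ≠ 0 → (siteLoopCurve δ γ).wind z ≠ 0) → ∫ z, f z = 0 → MeasurableSet {ω : SiteConfig (Site 2) | ω ∩ outsideSitesT γ ∈ B₀} → ∫ ω in {ω | IsSiteInterfaceLoop ω γ} ∩ {ω | ω ∩ outsideSitesT γ ∈ B₀}, (siteLoopConfig δ ω).nestingWeight f ∂PT = condTransformT δ γ f * (PT ({ω | IsSiteInterfaceLoop ω γ} ∩ {ω | ω ∩ outsideSitesT γ ∈ B₀})).toReal := by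
  intro δ v γ f B₀ hδ hf hf0 hBm
  set I : Set (SiteConfig (Site 2)) := {ω | IsSiteInterfaceLoop ω γ} with hI
  set B : Set (SiteConfig (Site 2)) := {ω : SiteConfig (Site 2) | ω ∩ outsideSitesT γ ∈ B₀} with hB
  have hIm : MeasurableSet I := measurableSet_setOf.2 (measurable_isSiteInterfaceLoop γ)
  -- degenerate case: `γ` is never an interface loop
  by_cases hex : ∃ ω₀ : SiteConfig (Site 2), IsSiteInterfaceLoop ω₀ γ
  swap
  · have hI0 : I = ∅ := Set.eq_empty_of_forall_notMem fun ω hω ↦ hex ⟨ω, hω⟩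
    rw [hI0, Set.empty_inter, Measure.restrict_empty, integral_zero_measure, measure_empty,
      ENNReal.toReal_zero, mul_zero]
  obtain ⟨ω₀, h₀⟩ := hex
  -- the inside weight, the pinned configuration, the pinned observable
  set g : SiteConfig (Site 2) → ℝ := fun ω ↦ ∏ᶠ u ∈ insideLoopsT δ γ ω, u.nestingFactor f with hg
  set ρ : SiteConfig (Site 2) → SiteConfig (Site 2) :=
    fun ω ↦ (ω ∩ insideSitesT γ) ∪ (ω₀ ∩ loopSitesT γ) with hρ
  set H : SiteConfig (Site 2) → ℝ := fun ω ↦ g (ρ ω) with hH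
  have hρI : ∀ ω, IsSiteInterfaceLoop (ρ ω) γ := fun ω ↦
    (isSiteInterfaceLoop_congr (ω := ρ ω) (ω' := ω₀) (w := γ) fun x hx ↦
      ⟨fun h ↦ h.elim (fun h ↦ absurd h.2 (Set.disjoint_right.1 disjoint_insideSitesT_loopSitesT hx))
        And.left, fun h ↦ Or.inr ⟨h, hx⟩⟩).2 h₀
  -- on `I` the pinned observable is the nesting weight
  have hHg : ∀ ω ∈ I, H ω = g ω := fun ω hω ↦ by
    simp only [hH, hg]
    rw [insideLoopsT_eq_of_agree (hρI ω) hω hδ]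
    rintro x (hx | hx)
    · exact ⟨fun h ↦ h.elim And.left fun h ↦
        absurd hx (Set.disjoint_right.1 disjoint_insideSitesT_loopSitesT h.2), fun h ↦ Or.inl ⟨h, hx⟩⟩
    · rw [← mem_iff_of_read h₀ hω hx]
      exact ⟨fun h ↦ h.elim (fun h ↦ absurd h.2 (Set.disjoint_right.1 disjoint_insideSitesT_loopSitesT hx))
        And.left, fun h ↦ Or.inr ⟨h, hx⟩⟩
  have hHw : ∀ ω ∈ I, (siteLoopConfig δ ω).nestingWeight f = H ω := fun ω hω ↦ by
    rw [hHg ω hω, hg, nestingWeight_eq_finprod_insideLoopsT hω hδ hf hf0]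
  -- `H` is determined by the finite set of inside sites, hence measurable
  have hHdet : ∀ ω, H (ω ∩ insideSitesT γ) = H ω := fun ω ↦ by
    simp only [hH, hρ, Set.inter_assoc, Set.inter_self]
  have hHm : Measurable H :=
    measurable_comp_inter_of_finite (finite_insideSitesT h₀)
      fun S : SiteConfig (Site 2) ↦ g (S ∪ (ω₀ ∩ loopSitesT γ))
  -- indicators of `I` and of `I ∩ B` are determined by the read and outside sites
  have hIdet : ∀ ω : SiteConfig (Site 2), ω ∩ (loopSitesT γ ∪ outsideSitesT γ) ∈ I ↔ ω ∈ I := fun ω ↦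
    isSiteInterfaceLoop_congr fun x hx ↦ ⟨fun h ↦ h.1, fun h ↦ ⟨h, Or.inl hx⟩⟩
  have hBdet : ∀ ω : SiteConfig (Site 2), ω ∩ (loopSitesT γ ∪ outsideSitesT γ) ∈ B ↔ ω ∈ B := fun ω ↦ by
    change _ ∩ outsideSitesT γ ∈ B₀ ↔ ω ∩ outsideSitesT γ ∈ B₀
    rw [Set.inter_assoc, Set.inter_eq_right.2 subset_union_right]
  have hdisj : Disjoint (insideSitesT γ) (loopSitesT γ ∪ outsideSitesT γ) :=
    Set.disjoint_union_right.2 ⟨disjoint_insideSitesT_loopSitesT, disjoint_insideSitesT_outsideSitesT⟩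
  have hdisj' : Disjoint (insideSitesT γ) (loopSitesT γ) := disjoint_insideSitesT_loopSitesT
  -- `E[H ; I ∩ B] = E[H] P(I ∩ B)` and `E[H ; I] = E[H] P(I)`
  have hfacIB : ∫ ω in I ∩ B, H ω ∂PT = (∫ ω, H ω ∂PT) * (PT (I ∩ B)).toReal := by
    have key := integral_mul_of_determined half hdisj (φ := H) (ψ := (I ∩ B).indicator 1) hHm
      ((measurable_indicator_const_iff 1).2 (hIm.inter hBm)) hHdet
      fun ω ↦ indicator_one_congr_of_iff (and_congr (hIdet ω) (hBdet ω))
    rw [setIntegral_eq_integral_mul_indicator_one (hIm.inter hBm)]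
    rw [integral_indicator_one (hIm.inter hBm)] at key
    exact key
  have hfacI : ∫ ω in I, H ω ∂PT = (∫ ω, H ω ∂PT) * (PT I).toReal := by
    have key := integral_mul_of_determined half hdisj' (φ := H) (ψ := I.indicator 1) hHm
      ((measurable_indicator_const_iff 1).2 hIm) hHdet
      fun ω ↦ indicator_one_congr_of_iff (isSiteInterfaceLoop_congr fun x hx ↦ ⟨fun h ↦ h.1, fun h ↦ ⟨h, hx⟩⟩)
    rw [setIntegral_eq_integral_mul_indicator_one hIm]
    rw [integral_indicator_one hIm] at key
    exact key
  -- assemble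
  have hLHS : ∫ ω in I ∩ B, (siteLoopConfig δ ω).nestingWeight f ∂PT = (∫ ω, H ω ∂PT) * (PT (I ∩ B)).toReal := by
    rw [setIntegral_congr_fun (hIm.inter hBm) fun ω hω ↦ hHw ω hω.1, hfacIB]
  have hcond : condTransformT δ γ f * (PT (I ∩ B)).toReal = (∫ ω, H ω ∂PT) * (PT (I ∩ B)).toReal := by
    by_cases hI0 : (PT I).toReal = 0
    · have hI0' : PT I = 0 := ((ENNReal.toReal_eq_zero_iff _).1 hI0).resolve_right (measure_ne_top _ _)
      rw [measure_mono_null inter_subset_left hI0', ENNReal.toReal_zero, mul_zero, mul_zero]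
    · congr 1
      change (∫ ω in I, g ω ∂PT) / (PT I).toReal = _
      rw [setIntegral_congr_fun hIm fun ω hω ↦ (hHg ω hω).symm, hfacI, mul_div_assoc, div_self hI0, mul_one]
  rw [hLHS, hcond]

/-- The registered stub is literally the statement `OneGenerationT` of the vocabulary module. -/
theorem oneGenerationT_of_stub : OneGenerationT := stub_oneGenerationT

end Summit.CriticalPhenomena.CardyFormulaZ2.Cruxes.NestingRigidity.MarkovCascadeOneGeneration

end
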